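import Mathlib
import Summits.AtomisticToContinuum.FouriersLaw.Theorems.EmbeddedDrudeMourreKineticConductivityFiniteFormDomain
import HarnessLib

/-!
# Quantitative transversality of the collision sheet off the exchange planes —
`stub_sheetTransversal` (stub TA) of line `swap-odd-threshold-rigidity`
(crux `EmbeddedDrudeMourre.MourreDissolution`, item stmt-AtomisticToContinuum-12594; helper file, `--supports`)

Registered stub TA of the checked skeleton of line `swap-odd-threshold-rigidity` (lead c8), in the
skeleton's stub namespace `Summit.AtomisticToContinuum.FouriersLaw.Theorems.MourreDissolution`,
registered in the shape `I1 → GL → TA`: the global factorisation I1 of the resonance function and the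
effective Jacobian floor GL on the resonant set are taken as HYPOTHESES (they are not restated as
declarations or reproved here).

Notation. `ω(k) = √(ω₂ + 2(1 − cos k))` (`PhononBoltzmann.dispersion`, `ω₂ > 0`), `ωⱼ = ω(kⱼ)`,
`k₄ = k₁ + k₂ − k₃`, `vⱼ = ω′(kⱼ) = sin kⱼ/ωⱼ` (`groupVelocity`, `hasDerivAt_dispersion`),
`Ω = ω₁ + ω₂ − ω₃ − ω₄` (`resonanceFn`), `D = (ω₁+ω₂+ω₃+ω₄)(ω₁ω₂+ω₃ω₄) > 0`,
`σ = sin((k₃−k₁)/2) sin((k₂−k₃)/2)`, and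
`H = (ω₁ω₂ + ω₃ω₄ + 2(ω₂+2)) cos((k₁+k₂)/2) − 4 cos((k₃−k₁)/2) cos((k₂−k₃)/2)` (the global defining
function of the collision sheet, I1: `Ω·D = 8σ·H`), `G = ∂H/∂k₂ =
(ω₁v₂ + ω₃v₄) cos((k₁+k₂)/2) − ½(ω₁ω₂ + ω₃ω₄ + 2(ω₂+2)) sin((k₁+k₂)/2) + 2 cos((k₃−k₁)/2) sin((k₂−k₃)/2)`.

Claim (TA). For `ω₂ > 0` there is `c′ > 0` with `c′ ≤ |G|` at every point of `{H = 0}` with `σ ≠ 0`.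

Proof. Fix `k₁, k₃`. Both sides of I1 are differentiable functions of the partner momentum `k₂`
(`hasDerivAt_resonanceFn`: `∂₂Ω = v₂ − v₄`; `hasDerivAt_dispersion`; product rule;
`d/dk₂ sin((k₂−k₃)/2) = ½ cos((k₂−k₃)/2)`; `∂₂H = G`), and equal functions have equal derivatives
(`HasDerivAt.unique`): `(v₂ − v₄)·D + Ω·∂₂D = 4 sin((k₃−k₁)/2) cos((k₂−k₃)/2)·H + 8σ·G`. At a point of
the sheet `H = 0`, I1 and `D > 0` give `Ω = 0`, so `(v₂ − v₄)·D = 8σ·G`. The Jacobian floor GL at this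
zero of `Ω` reads `c|σ| ≤ |v₂ − v₄|` (`resonanceJacobian = |v₂ − v₄|`), whence
`c|σ|·D ≤ |v₂ − v₄|·D = 8|σ||G|` and, `σ ≠ 0`, `|G| ≥ cD/8 ≥ c·ω₂√ω₂ =: c′`
(`D ≥ 4√ω₂ · 2ω₂`, `sqrt_le_dispersion`). Elementary calculus; no cited facts.
-/

noncomputable section

namespace Summit.AtomisticToContinuum.FouriersLaw.Theorems.MourreDissolution

open Literature.MathematicalPhysics.KineticTheory
open Literature.MathematicalPhysics.KineticTheory.PhononBoltzmann

/-! ### Derivatives in the partner momentum `k₂` -/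

/-- `d/dk₂ ω(k₁ + k₂ − k₃) = ω′(k₄)`, `k₄ = k₁ + k₂ − k₃` (`ω₂ > 0`). [folklore] -/
theorem sheetTransversal_hasDerivAt_dispersion_four {ω₂ : ℝ} (hω : 0 < ω₂) (k₁ k₂ k₃ : ℝ) :
    HasDerivAt (fun q => dispersion ω₂ (k₁ + q - k₃)) (groupVelocity ω₂ (k₁ + k₂ - k₃)) k₂ :=
  HasDerivAt.comp_const_add k₁ k₂
    (HasDerivAt.comp_sub_const (k₁ + k₂) k₃ (hasDerivAt_dispersion hω (k₁ + k₂ - k₃)))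

/-- `d/dk₂ cos((k₁ + k₂)/2) = −½ sin((k₁ + k₂)/2)`. [folklore] -/
theorem sheetTransversal_hasDerivAt_cos_half_sum (k₁ k₂ : ℝ) :
    HasDerivAt (fun q => Real.cos ((k₁ + q) / 2)) (-Real.sin ((k₁ + k₂) / 2) * (1 / 2)) k₂ :=
  (((hasDerivAt_id' k₂).const_add k₁).div_const 2).cos

/-- `d/dk₂ cos((k₂ − k₃)/2) = −½ sin((k₂ − k₃)/2)`. [folklore] -/
theorem sheetTransversal_hasDerivAt_cos_half_sub (k₂ k₃ : ℝ) :
    HasDerivAt (fun q => Real.cos ((q - k₃) / 2)) (-Real.sin ((k₂ - k₃) / 2) * (1 / 2)) k₂ :=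
  (((hasDerivAt_id' k₂).sub_const k₃).div_const 2).cos

/-- `d/dk₂ sin((k₂ − k₃)/2) = ½ cos((k₂ − k₃)/2)`. [folklore] -/
theorem sheetTransversal_hasDerivAt_sin_half_sub (k₂ k₃ : ℝ) :
    HasDerivAt (fun q => Real.sin ((q - k₃) / 2)) (Real.cos ((k₂ - k₃) / 2) * (1 / 2)) k₂ :=
  (((hasDerivAt_id' k₂).sub_const k₃).div_const 2).sin

/-- `d/dk₂ (ω₁ω₂ + ω₃ω₄) = ω₁v₂ + ω₃v₄` (`ω′ = v`, `dk₄/dk₂ = 1`). [folklore] -/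
theorem sheetTransversal_hasDerivAt_pairProduct {ω₂ : ℝ} (hω : 0 < ω₂) (k₁ k₂ k₃ : ℝ) :
    HasDerivAt
      (fun q => dispersion ω₂ k₁ * dispersion ω₂ q + dispersion ω₂ k₃ * dispersion ω₂ (k₁ + q - k₃))
      (dispersion ω₂ k₁ * groupVelocity ω₂ k₂ + dispersion ω₂ k₃ * groupVelocity ω₂ (k₁ + k₂ - k₃))
      k₂ :=
  ((hasDerivAt_dispersion hω k₂).const_mul (dispersion ω₂ k₁)).fun_add
    ((sheetTransversal_hasDerivAt_dispersion_four hω k₁ k₂ k₃).const_mul (dispersion ω₂ k₃))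

/-- `d/dk₂ (ω₁ + ω₂ + ω₃ + ω₄) = v₂ + v₄`. [folklore] -/
theorem sheetTransversal_hasDerivAt_sum {ω₂ : ℝ} (hω : 0 < ω₂) (k₁ k₂ k₃ : ℝ) :
    HasDerivAt
      (fun q => dispersion ω₂ k₁ + dispersion ω₂ q + dispersion ω₂ k₃ + dispersion ω₂ (k₁ + q - k₃))
      (groupVelocity ω₂ k₂ + groupVelocity ω₂ (k₁ + k₂ - k₃)) k₂ :=
  (((hasDerivAt_dispersion hω k₂).const_add (dispersion ω₂ k₁)).add_const (dispersion ω₂ k₃)).fun_add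
    (sheetTransversal_hasDerivAt_dispersion_four hω k₁ k₂ k₃)

/-- **`∂H/∂k₂ = G`.** The derivative in the partner momentum of the defining function
`H = (ω₁ω₂ + ω₃ω₄ + 2(ω₂+2)) cos((k₁+k₂)/2) − 4 cos((k₃−k₁)/2) cos((k₂−k₃)/2)` of the collision
sheet is `G = (ω₁v₂ + ω₃v₄) cos((k₁+k₂)/2) − ½(ω₁ω₂ + ω₃ω₄ + 2(ω₂+2)) sin((k₁+k₂)/2)
+ 2 cos((k₃−k₁)/2) sin((k₂−k₃)/2)`. [folklore] -/
theorem sheetTransversal_hasDerivAt_sheetFn {ω₂ : ℝ} (hω : 0 < ω₂) (k₁ k₂ k₃ : ℝ) :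
    HasDerivAt
      (fun q =>
        (dispersion ω₂ k₁ * dispersion ω₂ q + dispersion ω₂ k₃ * dispersion ω₂ (k₁ + q - k₃) +
              2 * (ω₂ + 2)) * Real.cos ((k₁ + q) / 2) -
          4 * Real.cos ((k₃ - k₁) / 2) * Real.cos ((q - k₃) / 2))
      ((dispersion ω₂ k₁ * groupVelocity ω₂ k₂ + dispersion ω₂ k₃ * groupVelocity ω₂ (k₁ + k₂ - k₃)) *
            Real.cos ((k₁ + k₂) / 2) -
          1 / 2 * (dispersion ω₂ k₁ * dispersion ω₂ k₂ +
              dispersion ω₂ k₃ * dispersion ω₂ (k₁ + k₂ - k₃) + 2 * (ω₂ + 2)) *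
            Real.sin ((k₁ + k₂) / 2) +
        2 * Real.cos ((k₃ - k₁) / 2) * Real.sin ((k₂ - k₃) / 2))
      k₂ := by
  have h := (((sheetTransversal_hasDerivAt_pairProduct hω k₁ k₂ k₃).add_const
    (2 * (ω₂ + 2))).fun_mul (sheetTransversal_hasDerivAt_cos_half_sum k₁ k₂)).fun_sub
    ((sheetTransversal_hasDerivAt_cos_half_sub k₂ k₃).const_mul (4 * Real.cos ((k₃ - k₁) / 2)))
  exact h.congr_deriv (by ring)

/-! ### Differentiating the factorisation along the fibre -/

/-- **The differentiated factorisation.** If on the `k₂`-fibre through `(k₁, k₃)` the factorisation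
`Ω·D = 8 sin((k₃−k₁)/2) sin((k₂−k₃)/2)·H` holds identically in `k₂` (stub I1), then, equal functions
having equal derivatives (`HasDerivAt.unique`),
`(v₂ − v₄)·D + Ω·∂₂D = 4 sin((k₃−k₁)/2) cos((k₂−k₃)/2)·H + 8 sin((k₃−k₁)/2) sin((k₂−k₃)/2)·G`
with `∂₂D = (v₂+v₄)(ω₁ω₂+ω₃ω₄) + (ω₁+ω₂+ω₃+ω₄)(ω₁v₂+ω₃v₄)`. [folklore] -/
theorem sheetTransversal_deriv_identity {ω₂ : ℝ} (hω : 0 < ω₂) {k₁ k₃ : ℝ}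
    (hI : ∀ q : ℝ,
      resonanceFn ω₂ k₁ q k₃ *
          ((dispersion ω₂ k₁ + dispersion ω₂ q + dispersion ω₂ k₃ + dispersion ω₂ (k₁ + q - k₃)) *
            (dispersion ω₂ k₁ * dispersion ω₂ q + dispersion ω₂ k₃ * dispersion ω₂ (k₁ + q - k₃))) =
        8 * Real.sin ((k₃ - k₁) / 2) * Real.sin ((q - k₃) / 2) *
          ((dispersion ω₂ k₁ * dispersion ω₂ q + dispersion ω₂ k₃ * dispersion ω₂ (k₁ + q - k₃) +
                2 * (ω₂ + 2)) * Real.cos ((k₁ + q) / 2) -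
            4 * Real.cos ((k₃ - k₁) / 2) * Real.cos ((q - k₃) / 2)))
    (k₂ : ℝ) :
    (groupVelocity ω₂ k₂ - groupVelocity ω₂ (k₁ + k₂ - k₃)) *
          ((dispersion ω₂ k₁ + dispersion ω₂ k₂ + dispersion ω₂ k₃ + dispersion ω₂ (k₁ + k₂ - k₃)) *
            (dispersion ω₂ k₁ * dispersion ω₂ k₂ + dispersion ω₂ k₃ * dispersion ω₂ (k₁ + k₂ - k₃))) +
        resonanceFn ω₂ k₁ k₂ k₃ *
          ((groupVelocity ω₂ k₂ + groupVelocity ω₂ (k₁ + k₂ - k₃)) *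
              (dispersion ω₂ k₁ * dispersion ω₂ k₂ + dispersion ω₂ k₃ * dispersion ω₂ (k₁ + k₂ - k₃)) +
            (dispersion ω₂ k₁ + dispersion ω₂ k₂ + dispersion ω₂ k₃ + dispersion ω₂ (k₁ + k₂ - k₃)) *
              (dispersion ω₂ k₁ * groupVelocity ω₂ k₂ +
                dispersion ω₂ k₃ * groupVelocity ω₂ (k₁ + k₂ - k₃))) =
      4 * Real.sin ((k₃ - k₁) / 2) * Real.cos ((k₂ - k₃) / 2) *
          ((dispersion ω₂ k₁ * dispersion ω₂ k₂ + dispersion ω₂ k₃ * dispersion ω₂ (k₁ + k₂ - k₃) +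
                2 * (ω₂ + 2)) * Real.cos ((k₁ + k₂) / 2) -
            4 * Real.cos ((k₃ - k₁) / 2) * Real.cos ((k₂ - k₃) / 2)) +
        8 * (Real.sin ((k₃ - k₁) / 2) * Real.sin ((k₂ - k₃) / 2)) *
          ((dispersion ω₂ k₁ * groupVelocity ω₂ k₂ +
                  dispersion ω₂ k₃ * groupVelocity ω₂ (k₁ + k₂ - k₃)) * Real.cos ((k₁ + k₂) / 2) -
              1 / 2 * (dispersion ω₂ k₁ * dispersion ω₂ k₂ +
                  dispersion ω₂ k₃ * dispersion ω₂ (k₁ + k₂ - k₃) + 2 * (ω₂ + 2)) *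
                Real.sin ((k₁ + k₂) / 2) +
            2 * Real.cos ((k₃ - k₁) / 2) * Real.sin ((k₂ - k₃) / 2)) := by
  -- derivative of the left-hand side `Ω·D` of I1
  have hF₁ := (hasDerivAt_resonanceFn hω k₁ k₂ k₃).fun_mul
    ((sheetTransversal_hasDerivAt_sum hω k₁ k₂ k₃).fun_mul
      (sheetTransversal_hasDerivAt_pairProduct hω k₁ k₂ k₃))
  -- derivative of the right-hand side `8 sin((k₃−k₁)/2) sin((k₂−k₃)/2)·H` of I1
  have hF₂ := ((sheetTransversal_hasDerivAt_sin_half_sub k₂ k₃).const_mul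
    (8 * Real.sin ((k₃ - k₁) / 2))).fun_mul (sheetTransversal_hasDerivAt_sheetFn hω k₁ k₂ k₃)
  -- transport the second along the identity of functions I1
  have hF₂' : HasDerivAt (fun q => resonanceFn ω₂ k₁ q k₃ *
      ((dispersion ω₂ k₁ + dispersion ω₂ q + dispersion ω₂ k₃ + dispersion ω₂ (k₁ + q - k₃)) *
        (dispersion ω₂ k₁ * dispersion ω₂ q + dispersion ω₂ k₃ * dispersion ω₂ (k₁ + q - k₃)))) _ k₂ :=
    hF₂.congr_of_eventuallyEq (Filter.Eventually.of_forall fun q => hI q)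
  linear_combination hF₁.unique hF₂'

/-! ### On the sheet -/

/-- `0 < 8 ω₂ √ω₂ ≤ D = (ω₁+ω₂+ω₃+ω₄)(ω₁ω₂+ω₃ω₄)` from the gap `√ω₂ ≤ ω` (`sqrt_le_dispersion`).
[folklore] -/
theorem sheetTransversal_factor_ge {ω₂ : ℝ} (hω : 0 < ω₂) (k₁ k₂ k₃ : ℝ) :
    8 * (ω₂ * Real.sqrt ω₂) ≤
      (dispersion ω₂ k₁ + dispersion ω₂ k₂ + dispersion ω₂ k₃ + dispersion ω₂ (k₁ + k₂ - k₃)) *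
        (dispersion ω₂ k₁ * dispersion ω₂ k₂ + dispersion ω₂ k₃ * dispersion ω₂ (k₁ + k₂ - k₃)) := by
  have hs : 0 ≤ Real.sqrt ω₂ := Real.sqrt_nonneg ω₂
  have h₁ : Real.sqrt ω₂ ≤ dispersion ω₂ k₁ := sqrt_le_dispersion k₁
  have h₂ : Real.sqrt ω₂ ≤ dispersion ω₂ k₂ := sqrt_le_dispersion k₂
  have h₃ : Real.sqrt ω₂ ≤ dispersion ω₂ k₃ := sqrt_le_dispersion k₃
  have h₄ : Real.sqrt ω₂ ≤ dispersion ω₂ (k₁ + k₂ - k₃) := sqrt_le_dispersion (k₁ + k₂ - k₃)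
  have hsq : Real.sqrt ω₂ * Real.sqrt ω₂ = ω₂ := Real.mul_self_sqrt hω.le
  have hS : 4 * Real.sqrt ω₂ ≤
      dispersion ω₂ k₁ + dispersion ω₂ k₂ + dispersion ω₂ k₃ + dispersion ω₂ (k₁ + k₂ - k₃) := by
    linarith
  have hP : 2 * ω₂ ≤
      dispersion ω₂ k₁ * dispersion ω₂ k₂ + dispersion ω₂ k₃ * dispersion ω₂ (k₁ + k₂ - k₃) := by
    have h12 := mul_le_mul h₁ h₂ hs (hs.trans h₁)
    have h34 := mul_le_mul h₃ h₄ hs (hs.trans h₃)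
    linarith
  calc 8 * (ω₂ * Real.sqrt ω₂) = (4 * Real.sqrt ω₂) * (2 * ω₂) := by ring
    _ ≤ _ := mul_le_mul hS hP (by positivity) (by linarith)

/-- `0 < D = (ω₁+ω₂+ω₃+ω₄)(ω₁ω₂+ω₃ω₄)` (`ω₂ > 0`). [folklore] -/
theorem sheetTransversal_factor_pos {ω₂ : ℝ} (hω : 0 < ω₂) (k₁ k₂ k₃ : ℝ) :
    0 < (dispersion ω₂ k₁ + dispersion ω₂ k₂ + dispersion ω₂ k₃ + dispersion ω₂ (k₁ + k₂ - k₃)) *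
        (dispersion ω₂ k₁ * dispersion ω₂ k₂ + dispersion ω₂ k₃ * dispersion ω₂ (k₁ + k₂ - k₃)) :=
  lt_of_lt_of_le (by positivity) (sheetTransversal_factor_ge hω k₁ k₂ k₃)

/-- On the sheet `H = 0` the resonance function vanishes: `Ω·D = 8σ·H = 0` (I1 on the fibre) and
`D > 0`. [folklore] -/
theorem sheetTransversal_resonanceFn_eq_zero {ω₂ : ℝ} (hω : 0 < ω₂) {k₁ k₂ k₃ : ℝ}
    (hI : ∀ q : ℝ,
      resonanceFn ω₂ k₁ q k₃ *
          ((dispersion ω₂ k₁ + dispersion ω₂ q + dispersion ω₂ k₃ + dispersion ω₂ (k₁ + q - k₃)) *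
            (dispersion ω₂ k₁ * dispersion ω₂ q + dispersion ω₂ k₃ * dispersion ω₂ (k₁ + q - k₃))) =
        8 * Real.sin ((k₃ - k₁) / 2) * Real.sin ((q - k₃) / 2) *
          ((dispersion ω₂ k₁ * dispersion ω₂ q + dispersion ω₂ k₃ * dispersion ω₂ (k₁ + q - k₃) +
                2 * (ω₂ + 2)) * Real.cos ((k₁ + q) / 2) -
            4 * Real.cos ((k₃ - k₁) / 2) * Real.cos ((q - k₃) / 2)))
    (hH : (dispersion ω₂ k₁ * dispersion ω₂ k₂ + dispersion ω₂ k₃ * dispersion ω₂ (k₁ + k₂ - k₃) +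
              2 * (ω₂ + 2)) * Real.cos ((k₁ + k₂) / 2) -
          4 * Real.cos ((k₃ - k₁) / 2) * Real.cos ((k₂ - k₃) / 2) = 0) :
    resonanceFn ω₂ k₁ k₂ k₃ = 0 := by
  have h := hI k₂
  rw [hH, mul_zero] at h
  exact (mul_eq_zero.1 h).resolve_right (sheetTransversal_factor_pos hω k₁ k₂ k₃).ne'

/-- **The velocity identity on the sheet.** At a point of `{H = 0}` (where `Ω = 0`), the
differentiated factorisation reads `(v₂ − v₄)·D = 8 sin((k₃−k₁)/2) sin((k₂−k₃)/2)·G`. [folklore] -/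
theorem sheetTransversal_velocity_identity {ω₂ : ℝ} (hω : 0 < ω₂) {k₁ k₂ k₃ : ℝ}
    (hI : ∀ q : ℝ,
      resonanceFn ω₂ k₁ q k₃ *
          ((dispersion ω₂ k₁ + dispersion ω₂ q + dispersion ω₂ k₃ + dispersion ω₂ (k₁ + q - k₃)) *
            (dispersion ω₂ k₁ * dispersion ω₂ q + dispersion ω₂ k₃ * dispersion ω₂ (k₁ + q - k₃))) =
        8 * Real.sin ((k₃ - k₁) / 2) * Real.sin ((q - k₃) / 2) *
          ((dispersion ω₂ k₁ * dispersion ω₂ q + dispersion ω₂ k₃ * dispersion ω₂ (k₁ + q - k₃) +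
                2 * (ω₂ + 2)) * Real.cos ((k₁ + q) / 2) -
            4 * Real.cos ((k₃ - k₁) / 2) * Real.cos ((q - k₃) / 2)))
    (hH : (dispersion ω₂ k₁ * dispersion ω₂ k₂ + dispersion ω₂ k₃ * dispersion ω₂ (k₁ + k₂ - k₃) +
              2 * (ω₂ + 2)) * Real.cos ((k₁ + k₂) / 2) -
          4 * Real.cos ((k₃ - k₁) / 2) * Real.cos ((k₂ - k₃) / 2) = 0) :
    (groupVelocity ω₂ k₂ - groupVelocity ω₂ (k₁ + k₂ - k₃)) *
        ((dispersion ω₂ k₁ + dispersion ω₂ k₂ + dispersion ω₂ k₃ + dispersion ω₂ (k₁ + k₂ - k₃)) *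
          (dispersion ω₂ k₁ * dispersion ω₂ k₂ + dispersion ω₂ k₃ * dispersion ω₂ (k₁ + k₂ - k₃))) =
      8 * (Real.sin ((k₃ - k₁) / 2) * Real.sin ((k₂ - k₃) / 2)) *
        ((dispersion ω₂ k₁ * groupVelocity ω₂ k₂ +
                dispersion ω₂ k₃ * groupVelocity ω₂ (k₁ + k₂ - k₃)) * Real.cos ((k₁ + k₂) / 2) -
            1 / 2 * (dispersion ω₂ k₁ * dispersion ω₂ k₂ +
                dispersion ω₂ k₃ * dispersion ω₂ (k₁ + k₂ - k₃) + 2 * (ω₂ + 2)) *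
              Real.sin ((k₁ + k₂) / 2) +
          2 * Real.cos ((k₃ - k₁) / 2) * Real.sin ((k₂ - k₃) / 2)) := by
  have hΩ := sheetTransversal_resonanceFn_eq_zero hω hI hH
  have key := sheetTransversal_deriv_identity hω hI k₂
  rw [hH, hΩ] at key
  linear_combination key

/-! ### The stub -/

/-- **Quantitative transversality of the collision sheet off the exchange planes** (stub TA of line
`swap-odd-threshold-rigidity`, registered as `I1 → GL → TA`). Assume the global factorisation
`Ω·(ω₁+ω₂+ω₃+ω₄)(ω₁ω₂+ω₃ω₄) = 8 sin((k₃−k₁)/2) sin((k₂−k₃)/2)·H` of the resonance function (I1,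
`ω₂ ≥ 0`) and the Jacobian floor `c|sin((k₃−k₁)/2) sin((k₂−k₃)/2)| ≤ |v₂ − v₄|` on the resonant set
(GL, `ω₂ > 0`). Then for every `ω₂ > 0` there is `c′ > 0` (namely `c′ = c·ω₂√ω₂`) such that at every
point of the sheet `{H = 0}` off the exchange planes `{sin((k₃−k₁)/2) sin((k₂−k₃)/2) = 0}` the
transversal derivative `G = ∂H/∂k₂ = (ω₁v₂ + ω₃v₄) cos((k₁+k₂)/2) − ½(ω₁ω₂+ω₃ω₄+2(ω₂+2)) sin((k₁+k₂)/2)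
+ 2 cos((k₃−k₁)/2) sin((k₂−k₃)/2)` satisfies `c′ ≤ |G|`. Proof: differentiate I1 in `k₂`
(`sheetTransversal_velocity_identity`: `(v₂ − v₄)·D = 8σ·G` on the sheet), insert GL at the zero
`Ω = 0` forced by `H = 0`, divide by `8|σ| > 0` and use `D ≥ 8 ω₂√ω₂`. [folklore] -/
theorem stub_sheetTransversal :
    (∀ ω₂ : ℝ, 0 ≤ ω₂ → ∀ k₁ k₂ k₃ : ℝ,
      resonanceFn ω₂ k₁ k₂ k₃ *
          ((dispersion ω₂ k₁ + dispersion ω₂ k₂ + dispersion ω₂ k₃ + dispersion ω₂ (k₁ + k₂ - k₃)) *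
            (dispersion ω₂ k₁ * dispersion ω₂ k₂ + dispersion ω₂ k₃ * dispersion ω₂ (k₁ + k₂ - k₃))) =
        8 * Real.sin ((k₃ - k₁) / 2) * Real.sin ((k₂ - k₃) / 2) *
          ((dispersion ω₂ k₁ * dispersion ω₂ k₂ + dispersion ω₂ k₃ * dispersion ω₂ (k₁ + k₂ - k₃) +
                2 * (ω₂ + 2)) * Real.cos ((k₁ + k₂) / 2) -
            4 * Real.cos ((k₃ - k₁) / 2) * Real.cos ((k₂ - k₃) / 2))) →
    (∀ ω₂ : ℝ, 0 < ω₂ → ∃ c : ℝ, 0 < c ∧ ∀ k₁ k₂ k₃ : ℝ, resonanceFn ω₂ k₁ k₂ k₃ = 0 →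
      c * |Real.sin ((k₃ - k₁) / 2) * Real.sin ((k₂ - k₃) / 2)| ≤ resonanceJacobian ω₂ k₁ k₂ k₃) →
    ∀ ω₂ : ℝ, 0 < ω₂ → ∃ c : ℝ, 0 < c ∧ ∀ k₁ k₂ k₃ : ℝ,
      ((dispersion ω₂ k₁ * dispersion ω₂ k₂ + dispersion ω₂ k₃ * dispersion ω₂ (k₁ + k₂ - k₃) +
              2 * (ω₂ + 2)) * Real.cos ((k₁ + k₂) / 2) -
          4 * Real.cos ((k₃ - k₁) / 2) * Real.cos ((k₂ - k₃) / 2)) = 0 →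
      Real.sin ((k₃ - k₁) / 2) * Real.sin ((k₂ - k₃) / 2) ≠ 0 →
      c ≤ |((dispersion ω₂ k₁ * groupVelocity ω₂ k₂ + dispersion ω₂ k₃ * groupVelocity ω₂ (k₁ + k₂ - k₃)) *
              Real.cos ((k₁ + k₂) / 2) -
            1 / 2 * (dispersion ω₂ k₁ * dispersion ω₂ k₂ + dispersion ω₂ k₃ * dispersion ω₂ (k₁ + k₂ - k₃) +
              2 * (ω₂ + 2)) * Real.sin ((k₁ + k₂) / 2) +
          2 * Real.cos ((k₃ - k₁) / 2) * Real.sin ((k₂ - k₃) / 2))| := by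
  intro hI1 hGL ω₂ hω
  obtain ⟨c, hc, hJ⟩ := hGL ω₂ hω
  refine ⟨c * (ω₂ * Real.sqrt ω₂), by positivity, ?_⟩
  intro k₁ k₂ k₃ hH hσ
  -- the fibre through `(k₁, k₃)` of the factorisation I1
  have hI := fun q : ℝ => hI1 ω₂ hω.le k₁ q k₃
  -- names for the players
  set J := groupVelocity ω₂ k₂ - groupVelocity ω₂ (k₁ + k₂ - k₃)
  set D := (dispersion ω₂ k₁ + dispersion ω₂ k₂ + dispersion ω₂ k₃ + dispersion ω₂ (k₁ + k₂ - k₃)) *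
    (dispersion ω₂ k₁ * dispersion ω₂ k₂ + dispersion ω₂ k₃ * dispersion ω₂ (k₁ + k₂ - k₃))
  set σ := Real.sin ((k₃ - k₁) / 2) * Real.sin ((k₂ - k₃) / 2)
  set G := (dispersion ω₂ k₁ * groupVelocity ω₂ k₂ +
          dispersion ω₂ k₃ * groupVelocity ω₂ (k₁ + k₂ - k₃)) * Real.cos ((k₁ + k₂) / 2) -
      1 / 2 * (dispersion ω₂ k₁ * dispersion ω₂ k₂ +
          dispersion ω₂ k₃ * dispersion ω₂ (k₁ + k₂ - k₃) + 2 * (ω₂ + 2)) * Real.sin ((k₁ + k₂) / 2) +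
    2 * Real.cos ((k₃ - k₁) / 2) * Real.sin ((k₂ - k₃) / 2)
  -- (v₂ − v₄)·D = 8σ·G on the sheet
  have hkey : J * D = 8 * σ * G := sheetTransversal_velocity_identity hω hI hH
  -- D ≥ 8 ω₂ √ω₂ > 0
  have hDge : 8 * (ω₂ * Real.sqrt ω₂) ≤ D := sheetTransversal_factor_ge hω k₁ k₂ k₃
  have hDpos : 0 < D := sheetTransversal_factor_pos hω k₁ k₂ k₃
  -- GL at the zero `Ω = 0`: c|σ| ≤ |J|
  have hΩ : resonanceFn ω₂ k₁ k₂ k₃ = 0 := sheetTransversal_resonanceFn_eq_zero hω hI hH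
  have hJσ : c * |σ| ≤ |J| := hJ k₁ k₂ k₃ hΩ
  have hσpos : 0 < |σ| := abs_pos.2 hσ
  -- |J|·D = 8|σ||G|
  have habs : |J| * D = 8 * |σ| * |G| := by
    calc |J| * D = |J * D| := by rw [abs_mul, abs_of_pos hDpos]
      _ = |8 * σ * G| := by rw [hkey]
      _ = 8 * |σ| * |G| := by rw [abs_mul, abs_mul, abs_of_pos (by norm_num : (0 : ℝ) < 8)]
  -- c·D ≤ 8|G|
  have h1 : c * D ≤ 8 * |G| := by
    refine le_of_mul_le_mul_left ?_ hσpos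
    calc |σ| * (c * D) = c * |σ| * D := by ring
      _ ≤ |J| * D := mul_le_mul_of_nonneg_right hJσ hDpos.le
      _ = 8 * |σ| * |G| := habs
      _ = |σ| * (8 * |G|) := by ring
  calc c * (ω₂ * Real.sqrt ω₂) = c * (8 * (ω₂ * Real.sqrt ω₂)) / 8 := by ring
    _ ≤ c * D / 8 := by gcongr
    _ ≤ |G| := by linarith

end Summit.AtomisticToContinuum.FouriersLaw.Theorems.MourreDissolution
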